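import Summits.CriticalPhenomena.PercolationContinuityZ3.Theorems.PercNearOneGluingNoHeavyPcintMemoryTailLaw
import Literature.Probability.RandomPlanarGeometry.HammersleyWelshBound
import Literature.Probability.Percolation.GMBlockScheme
import HarnessLib

/-!
# CriticalPhenomena/PercolationContinuityZ3 — Theorems/PercNearOneGluingNoHeavyPcintMemoryTailLimit.lean: the PROVED envelope of the memory-tail law

Lane prim-pcint (paper-2 track (iii)), coordinator STANDING RULE «NUMERICS ⇒ STRUCTURE ⇒ CONJECTURE», item (4) "nulls mined for
WHY".  The typed conjecture C1′ (`…PcintMemoryTailLaw.lean`: `MemoryTail.lawLow / lawHigh / lawFour`) is about the RATE at which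
`L_d(τ) := logRatio d τ = ln(μ_τ(d)/μ(d))` tends to `0` (`≍ τ^{-1}` for `d ≤ 3`, `≍ τ^{1-d/2}` for `d ≥ 5`).  That file proved only
`0 ≤ L_d(τ)` and monotonicity; the CONVERGENCE `μ_τ(d) ↓ μ(d)` (Madras–Slade 1993, Lemma 1.2.3) was cited, not proved.  This file
proves it, in the tree's vocabulary and with no hypothesis, together with the best PROVED rate — the Hammersley–Welsh envelope:

* `isSAW_of_isMem`, `memWords_eq_sawWords`, `memCount_eq_card_sawWords` — for `n ≤ τ` a memory-`τ` word IS self-avoiding, so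
  `c_{n,τ} = #sawWords d n` (Madras–Slade: "`c_{N,τ} = c_N` for `N ≤ τ`");
* `wordPath_mem_saws`, `wordPath_injective`, `card_sawWords_eq_count` — the bridge between the two SAW models of the tree is an EQUALITY
  `#Percolation.sawWords d n = SAW.Zd.count d n` (the tree had only `≤`, `SAW.Zd.count_le_card_sawWords`);
* `memGrowth_le_count_rpow` — **`μ_τ(d) ≤ c_τ(d)^{1/τ}`** (`τ ≥ 1`): the `n = τ` term of the infimum defining `μ_τ`;
* `tendsto_memGrowth` — **`μ_τ(d) → μ(d)`** as `τ → ∞` (squeeze between `μ ≤ μ_τ` and `c_τ^{1/τ} → μ`, `SAW.Zd.tendsto_count_rpow`);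
  `tendsto_logRatio`, `tendsto_logRatio_even` — `L_d(τ) → 0` (also along the even memories used by the typed Props);
* `logRatio_le_of_count_le` — any enumeration bound `c_τ ≤ μ^τ·E` gives `L_d(τ) ≤ (ln E)/τ`;
* `logRatio_le_explicit` — **`L_d(τ) ≤ (ln μ + ln(τ+1) + 6√(τ+1))/τ`** for every `d ≥ 1`, `τ ≥ 1`, from the tree's explicit
  Hammersley–Welsh chain `c_τ ≤ (τ+1)e^{6√(τ+1)} b_{τ+1} ≤ (τ+1)e^{6√(τ+1)} μ^{τ+1}`;
* `exists_sqrt_mul_logRatio_le` — **`√τ · L_d(τ) ≤ κ_d`** for all `τ ≥ 1` (`d ≥ 2`; `SAW.Zd.BDGS2012_HammersleyWelsh_holds`), and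
  `memGrowth_le_mul_exp_div_sqrt` — `μ_τ ≤ μ · e^{κ/√τ}`.

STRUCTURE READING (STRUCTURE.md §4, null N6 of gen 13): the law's exponent is PROVED to be `≥ 1/2` in every `d ≥ 2` and CONJECTURED
to be `1` (`d = 2, 3`), `1⁺ˡᵒᵍ` (`d = 4`), `d/2 − 1` (`d ≥ 5`).  The gap `1/2 → 1` is exactly the Hammersley–Welsh barrier: any bound
`c_n ≤ μ^n e^{o(√n)}` with an effective rate (Hutchcroft 2018 gives `o(√n)` ineffectively; the predicted `c_n ∼ A μ^n n^{γ-1}` would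
give `L_d(τ) ≤ ((γ-1) ln τ + ln A)/τ`) improves the proved exponent here verbatim through `logRatio_le_of_count_le`.  Conversely the law
predicts what finite memory can never do: `μ_τ^τ ≥ μ^τ e^{κ_d + o(1)}` (`d ≤ 3`), i.e. memory truncation at ANY `τ` loses a constant
factor `e^{κ_3} ≈ 1.18` on `ℤ³` against `c_τ^{1/τ}`-type bounds — the numerics of gen 12 (gen12/DATA.txt) sit at `τ·L_3(τ) = 0.163`
for `τ = 14, 16, 18`, while the proved envelope at `τ = 18` is `√18·L ≤ κ`, numerically `L_3(18) = 0.00906 ≤ (ln 4.684 + ln 19 + 6√19)/18 = 1.70`.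

Sources: N. Madras, G. Slade, The Self-Avoiding Walk (1993), §1.2 (1.2.12)–(1.2.13), Lemma 1.2.3 [MadrasSlade1993]; J. M. Hammersley,
D. J. A. Welsh (1962) as printed in Madras–Slade Theorem 3.1.1 and BDGS 2012 (1.25) [BDGS2012].  Everything here is PROVED (no named
fact taken); nothing is used by a certified `p_c` cell.  Written by prim-pcint-2 gen 13 (prover-prim-pcint-2-g13-0), 2026-08-23.
-/

noncomputable section

open Filter Topology
open Literature.Probability.LatticeModels Literature.Probability.Percolation
open Literature.Probability.RandomPlanarGeometry.SAW.Zd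
open Summit.CriticalPhenomena.PercolationContinuityZ3.Theorems.Pcint (IsMem isMem_of_isSAW)

namespace Summit.CriticalPhenomena.PercolationContinuityZ3.Theorems.Pcint.MemoryTail

variable {d : ℕ}

/-! ### `c_{n,τ} = c_n` for `n ≤ τ` -/

/-- A memory-`τ` word of length `n ≤ τ` is self-avoiding (all pairs of times are within the memory window).
[cite: MadrasSlade1993, §1.2, proof of Lemma 1.2.3 ("c_{N,τ} = c_N if N ≤ τ")] -/
theorem isSAW_of_isMem {τ n : ℕ} (hn : n ≤ τ) {w : Fin n → Fin d × Bool} (h : IsMem τ w) : IsSAW w := by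
  intro i j hi hj hij
  by_contra hne
  rcases Nat.lt_or_gt_of_ne hne with hlt | hlt
  · exact h i j hj hlt (by omega) hij
  · exact h j i hi hlt (by omega) hij.symm

/-- For `n ≤ τ` the memory-`τ` words of length `n` are exactly the self-avoiding words.
[cite: MadrasSlade1993, §1.2, proof of Lemma 1.2.3] -/
theorem memWords_eq_sawWords {τ n : ℕ} (hn : n ≤ τ) (d : ℕ) : memWords d τ n = sawWords d n := by
  refine Finset.Subset.antisymm (fun w hw => ?_) (sawWords_subset_memWords d τ n)
  rw [mem_memWords] at hw
  exact mem_sawWords.2 (isSAW_of_isMem hn hw)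

/-- `c_{n,τ} = #sawWords d n` for `n ≤ τ`. [cite: MadrasSlade1993, §1.2, proof of Lemma 1.2.3] -/
theorem memCount_eq_card_sawWords {τ n : ℕ} (hn : n ≤ τ) (d : ℕ) : memCount d τ n = (sawWords d n).card := by
  rw [memCount, memWords_eq_sawWords hn]

/-! ### The bridge `#sawWords d n = c_n` (equality of the tree's two SAW counts) -/

/-- The lattice path `i ↦ wordPos w (min i n)` of a self-avoiding word (frozen after its `n` steps, the format of
`SAW.Zd.saws`) is an `n`-step self-avoiding walk from the origin. [cite: MadrasSlade1993, §1.1] -/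
theorem wordPath_mem_saws {n : ℕ} {w : Fin n → Fin d × Bool} (hw : IsSAW w) :
    (fun i : ℕ => wordPos w (min i n)) ∈ saws d n := by
  rw [mem_saws]
  refine ⟨by simp, fun i hi => by simp [min_eq_right hi], fun i hi => ?_, fun i hi j hj hij => ?_⟩
  · rw [zdGraph_adj_iff_stepVec]
    refine ⟨w ⟨i, hi⟩, ?_⟩
    simp only [min_eq_left hi.le, min_eq_left (Nat.succ_le_of_lt hi)]
    exact wordPos_succ w hi
  · simp only [Set.mem_setOf_eq] at hi hj
    simp only [min_eq_left hi, min_eq_left hj] at hij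
    exact hw i j hi hj hij

/-- A step word is determined by its lattice path (the unit steps `stepVec` are pairwise distinct,
`GMStep.stepVec_injective`). [folklore] -/
theorem wordPath_injective (n : ℕ) :
    Function.Injective (fun (w : Fin n → Fin d × Bool) (i : ℕ) => wordPos w (min i n)) := by
  intro w w' h
  funext ⟨i, hi⟩
  have h0 := congrFun h i
  have h1 := congrFun h (i + 1)
  simp only [min_eq_left hi.le, min_eq_left (Nat.succ_le_of_lt hi), wordPos_succ w hi,
    wordPos_succ w' hi] at h0 h1
  rw [h0] at h1
  exact GMStep.stepVec_injective d (add_left_cancel h1)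

/-- **`#sawWords d n = c_n(ℤ^d)`**: the step-word count of `Percolation.sawWords` and the walk count `SAW.Zd.count` agree
(the tree's `SAW.Zd.count_le_card_sawWords` is the half `≤`; the other half is the injection `w ↦ (i ↦ wordPos w (min i n))`).
[cite: MadrasSlade1993, §1.1] -/
theorem card_sawWords_eq_count (d n : ℕ) [NeZero d] : (sawWords d n).card = count d n := by
  refine le_antisymm ?_ (count_le_card_sawWords d n)
  rw [← card_saws]
  refine Finset.card_le_card_of_injOn (fun (w : Fin n → Fin d × Bool) (i : ℕ) => wordPos w (min i n))
    (fun w hw => ?_) (wordPath_injective n).injOn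
  rw [Finset.mem_coe] at hw
  exact Finset.mem_coe.2 (wordPath_mem_saws (mem_sawWords.1 hw))

/-- `c_{n,τ} = c_n` for `n ≤ τ` and `d ≥ 1`. [cite: MadrasSlade1993, §1.2, proof of Lemma 1.2.3] -/
theorem memCount_eq_count [NeZero d] {τ n : ℕ} (hn : n ≤ τ) : memCount d τ n = count d n := by
  rw [memCount_eq_card_sawWords hn, card_sawWords_eq_count]

/-! ### `μ ≤ μ_τ ≤ c_τ^{1/τ}` and `μ_τ → μ` -/

/-- Every term bounds the infimum: `μ_τ(d) ≤ c_{n+1,τ}^{1/(n+1)}`. [cite: MadrasSlade1993, §1.2 (1.2.12)] -/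
theorem memGrowth_le_memCount_rpow (d τ n : ℕ) :
    memGrowth d τ ≤ (memCount d τ (n + 1) : ℝ) ^ (1 / ((n : ℝ) + 1)) :=
  ciInf_le (bddBelow_memRpow d τ) n

/-- **`μ_τ(d) ≤ c_τ(d)^{1/τ}`** for `τ ≥ 1` (the `n = τ` term, where `c_{τ,τ} = c_τ`). [cite: MadrasSlade1993, §1.2, proof of Lemma 1.2.3] -/
theorem memGrowth_le_count_rpow [NeZero d] {τ : ℕ} (hτ : 1 ≤ τ) :
    memGrowth d τ ≤ (count d τ : ℝ) ^ (1 / (τ : ℝ)) := by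
  obtain ⟨n, rfl⟩ : ∃ n, τ = n + 1 := ⟨τ - 1, by omega⟩
  have h := memGrowth_le_memCount_rpow d (n + 1) n
  rw [memCount_eq_count le_rfl] at h
  simpa [Nat.cast_succ] using h

/-- **Madras–Slade Lemma 1.2.3: `μ_τ(d) → μ(d)` as `τ → ∞`** (for every `d ≥ 1`), by the squeeze
`μ ≤ μ_τ ≤ c_τ^{1/τ} → μ`. [cite: MadrasSlade1993, §1.2, Lemma 1.2.3] -/
theorem tendsto_memGrowth [NeZero d] :
    Tendsto (fun τ : ℕ => memGrowth d τ) atTop (𝓝 (connectiveConstant d)) := by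
  refine tendsto_of_tendsto_of_tendsto_of_le_of_le' tendsto_const_nhds (tendsto_count_rpow d)
    (Eventually.of_forall fun τ => connectiveConstant_le_memGrowth τ) ?_
  filter_upwards [eventually_ge_atTop 1] with τ hτ using memGrowth_le_count_rpow hτ

/-- `L_d(τ) = ln(μ_τ/μ) → 0` as `τ → ∞` (`d ≥ 1`): the quantity whose RATE the typed conjecture C1′ describes does tend
to zero. [cite: MadrasSlade1993, §1.2, Lemma 1.2.3] -/
theorem tendsto_logRatio [NeZero d] : Tendsto (fun τ : ℕ => logRatio d τ) atTop (𝓝 0) := by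
  have hμ := connectiveConstant_pos d
  have h1 : Tendsto (fun τ : ℕ => memGrowth d τ / connectiveConstant d) atTop (𝓝 1) := by
    have := (tendsto_memGrowth (d := d)).div_const (connectiveConstant d)
    rwa [div_self hμ.ne'] at this
  have h2 := ((Real.continuousAt_log one_ne_zero).tendsto).comp h1
  rw [Real.log_one] at h2
  exact h2

/-- The same along even memories `τ = 2m` (the subsequence used by `lawLow` / `lawHigh` / `lawFour`). [cite: MadrasSlade1993, §1.2, Lemma 1.2.3] -/
theorem tendsto_logRatio_even [NeZero d] : Tendsto (fun m : ℕ => logRatio d (2 * m)) atTop (𝓝 0) :=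
  (tendsto_logRatio (d := d)).comp (tendsto_atTop_atTop.2 fun b => ⟨b, fun m hm => by omega⟩)

/-! ### The proved rate: Hammersley–Welsh envelope `L_d(τ) = O(τ^{-1/2})` -/

/-- Transfer principle: an enumeration bound `c_τ ≤ μ^τ · E` (`E > 0`, `τ ≥ 1`) gives `L_d(τ) ≤ (ln E)/τ`.
[cite: MadrasSlade1993, §1.2, Lemma 1.2.3 with (1.2.10)] -/
theorem logRatio_le_of_count_le [NeZero d] {τ : ℕ} (hτ : 1 ≤ τ) {E : ℝ} (hE : 0 < E)
    (h : (count d τ : ℝ) ≤ connectiveConstant d ^ τ * E) : logRatio d τ ≤ Real.log E / τ := by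
  have hμ := connectiveConstant_pos d
  have hτ' : (0 : ℝ) < τ := by exact_mod_cast hτ
  have hc : (0 : ℝ) < count d τ := by exact_mod_cast one_le_count d τ
  have hmg : 0 < memGrowth d τ := hμ.trans_le (connectiveConstant_le_memGrowth τ)
  have h1 : Real.log (memGrowth d τ) ≤ Real.log (count d τ) / τ := by
    have := Real.log_le_log hmg (memGrowth_le_count_rpow hτ)
    rwa [Real.log_rpow hc, one_div, inv_mul_eq_div] at this
  have h2 : Real.log (count d τ) ≤ τ * Real.log (connectiveConstant d) + Real.log E := by
    have := Real.log_le_log hc h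
    rwa [Real.log_mul (pow_pos hμ τ).ne' hE.ne', Real.log_pow] at this
  have h3 : Real.log (count d τ) / τ ≤ Real.log (connectiveConstant d) + Real.log E / τ := by
    rw [div_le_iff₀ hτ', add_mul, div_mul_cancel₀ _ hτ'.ne']
    linarith
  unfold logRatio
  rw [Real.log_div hmg.ne' hμ.ne']
  linarith

/-- **Explicit envelope, every `d ≥ 1`, `τ ≥ 1`: `L_d(τ) ≤ (ln μ(d) + ln(τ+1) + 6√(τ+1))/τ`**, from the tree's explicit
Hammersley–Welsh chain `c_τ ≤ (τ+1)e^{6√(τ+1)} b_{τ+1}` (`SAW.Zd.count_le_mul_exp_mul_bridgeCount`) and `b_n ≤ μ^n`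
(`SAW.Zd.bridgeCount_le_pow`). [cite: MadrasSlade1993, §3.1, Theorem 3.1.1 and (3.1.7)] -/
theorem logRatio_le_explicit [NeZero d] {τ : ℕ} (hτ : 1 ≤ τ) :
    logRatio d τ ≤ (Real.log (connectiveConstant d) + Real.log ((τ : ℝ) + 1) + 6 * Real.sqrt ((τ : ℝ) + 1)) / τ := by
  have hμ := connectiveConstant_pos d
  have hτ1 : (0 : ℝ) < (τ : ℝ) + 1 := by positivity
  set E : ℝ := connectiveConstant d * (((τ : ℝ) + 1) * Real.exp (6 * Real.sqrt ((τ : ℝ) + 1))) with hE_def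
  have hE : 0 < E := by positivity
  have hcount : (count d τ : ℝ) ≤ connectiveConstant d ^ τ * E := by
    have h1 := count_le_mul_exp_mul_bridgeCount (d := d) τ
    have h2 : (bridgeCount d (τ + 1) : ℝ) ≤ connectiveConstant d ^ (τ + 1) := bridgeCount_le_pow (τ + 1)
    calc (count d τ : ℝ) ≤ ((τ : ℝ) + 1) * Real.exp (6 * Real.sqrt ((τ : ℝ) + 1)) * bridgeCount d (τ + 1) := h1
      _ ≤ ((τ : ℝ) + 1) * Real.exp (6 * Real.sqrt ((τ : ℝ) + 1)) * connectiveConstant d ^ (τ + 1) :=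
          mul_le_mul_of_nonneg_left h2 (by positivity)
      _ = connectiveConstant d ^ τ * E := by rw [hE_def, pow_succ]; ring
  have h := logRatio_le_of_count_le hτ hE hcount
  have hlogE : Real.log E = Real.log (connectiveConstant d) + Real.log ((τ : ℝ) + 1) + 6 * Real.sqrt ((τ : ℝ) + 1) := by
    rw [hE_def, Real.log_mul hμ.ne' (by positivity), Real.log_mul hτ1.ne' (Real.exp_pos _).ne', Real.log_exp]
    ring
  rwa [hlogE] at h

/-- **`√τ · L_d(τ) ≤ κ_d` for all `τ ≥ 1`** (`d ≥ 2`): the memory-tail law's exponent is PROVED to be at least `1/2`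
(Hammersley–Welsh `c_n ≤ μ^n e^{κ√n}`, the tree's `SAW.Zd.BDGS2012_HammersleyWelsh_holds`); C1′ conjectures `1` for `d ≤ 3`
and `d/2 − 1` for `d ≥ 5`. [cite: BDGS2012, §1.5.1, eq. (1.25)] -/
theorem exists_sqrt_mul_logRatio_le (hd : 2 ≤ d) :
    ∃ κ : ℝ, ∀ τ : ℕ, 1 ≤ τ → Real.sqrt τ * logRatio d τ ≤ κ := by
  haveI : NeZero d := ⟨by omega⟩
  obtain ⟨κ, hκ⟩ := BDGS2012_HammersleyWelsh_holds d hd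
  refine ⟨κ, fun τ hτ => ?_⟩
  have hτ' : (0 : ℝ) < τ := by exact_mod_cast hτ
  have hs : 0 < Real.sqrt τ := Real.sqrt_pos.2 hτ'
  have h := logRatio_le_of_count_le hτ (Real.exp_pos _) (hκ τ)
  rw [Real.log_exp] at h
  have h' : logRatio d τ ≤ κ / Real.sqrt τ := by
    calc logRatio d τ ≤ κ * Real.sqrt τ / τ := h
      _ = κ / Real.sqrt τ := by
          rw [div_eq_div_iff hτ'.ne' hs.ne', mul_assoc, Real.mul_self_sqrt hτ'.le]
  rwa [le_div_iff₀ hs, mul_comm] at h'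

/-- `μ_τ(d) ≤ μ(d) · e^{κ_d/√τ}` for all `τ ≥ 1` (`d ≥ 2`): the Hammersley–Welsh envelope on the growth constants themselves.
[cite: BDGS2012, §1.5.1, eq. (1.25)] -/
theorem memGrowth_le_mul_exp_div_sqrt (hd : 2 ≤ d) :
    ∃ κ : ℝ, ∀ τ : ℕ, 1 ≤ τ → memGrowth d τ ≤ connectiveConstant d * Real.exp (κ / Real.sqrt τ) := by
  haveI : NeZero d := ⟨by omega⟩
  obtain ⟨κ, hκ⟩ := exists_sqrt_mul_logRatio_le hd
  refine ⟨κ, fun τ hτ => ?_⟩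
  have hμ := connectiveConstant_pos d
  have hmg : 0 < memGrowth d τ := hμ.trans_le (connectiveConstant_le_memGrowth τ)
  have hs : 0 < Real.sqrt τ := Real.sqrt_pos.2 (by exact_mod_cast hτ)
  have h1 : logRatio d τ ≤ κ / Real.sqrt τ := by
    rw [le_div_iff₀ hs, mul_comm]; exact hκ τ hτ
  have h2 : memGrowth d τ / connectiveConstant d ≤ Real.exp (κ / Real.sqrt τ) := by
    have := Real.exp_le_exp.2 h1
    rwa [logRatio, Real.exp_log (div_pos hmg hμ)] at this
  rwa [div_le_iff₀' hμ] at h2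

end Summit.CriticalPhenomena.PercolationContinuityZ3.Theorems.Pcint.MemoryTail
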